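import Summits.AtomisticToContinuum.Crystallization.Theorems.ExcessDecayLiouvilleLatticeCoordinates

/-!
# Route `ExcessDecayLiouville`: the linear map attached to three lattice differences

Step (c4), item (T3) of evidence v4/v5, of the energy route for item `ExcessDecay` (stmt-AtomisticToContinuum-9334):
given three vectors `D₁, D₂, D₃` (the centre differences of the displacement along `A u₁`, `A u₂`, `A w₃`) and an
admissible cell `A`, there is a continuous linear map `B` with

`B (A z(i,j,k)) = i • D₁ + j • D₂ + k • D₃`  for all `(i,j,k) ∈ ℤ³`,   `‖B‖ ≤ 4 (‖D₁‖ + ‖D₂‖ + ‖D₃‖)`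

(`exists_linearPart`): `B = M ∘ A⁻¹` with `M` the explicit map sending `u₁, u₂, w₃` to `D₁, D₂, D₃` (coordinates
`a = v₀ − v₁/√3`, `b = 2v₁/√3`, `c = v₂/(2√(2/3))`) and `‖A⁻¹‖ ≤ 200/189`.  Together with `norm_taylor3_le` this gives
the affine approximation `u(q) − u(x₀) − B(q − x₀)` on a sublattice in terms of second differences.
All `[folklore]`; helper lemmas, nothing here closes an item.
-/

noncomputable section

namespace Summit.AtomisticToContinuum.Crystallization.Theorems.ExcessDecayLiouville

open scoped BigOperators
open Literature.MathematicalPhysics.StatisticalMechanics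
open Summit.AtomisticToContinuum.Crystallization.Theorems.PhononStabilityNegative

/-- The explicit coordinate map `M v = (v₀ − v₁/√3) • D₁ + (2v₁/√3) • D₂ + (v₂/(2√(2/3))) • D₃` sends
`u₁, u₂, w₃` to `D₁, D₂, D₃`, is linear, and `‖M v‖ ≤ 4‖v‖ (‖D₁‖+‖D₂‖+‖D₃‖)`… we package it as a continuous linear
map through `LinearMap.mkContinuous`. [folklore] -/
theorem exists_coordMap (D₁ D₂ D₃ : EuclideanSpace ℝ (Fin 3)) :
    ∃ M : EuclideanSpace ℝ (Fin 3) →L[ℝ] EuclideanSpace ℝ (Fin 3),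
      (∀ v : EuclideanSpace ℝ (Fin 3), M v = (v 0 - v 1 / Real.sqrt 3) • D₁ + (2 * v 1 / Real.sqrt 3) • D₂ +
        (v 2 / (2 * Real.sqrt (2 / 3))) • D₃) ∧
      ‖M‖ ≤ 3 * (‖D₁‖ + ‖D₂‖ + ‖D₃‖) := by
  have hs3 : (0 : ℝ) < Real.sqrt 3 := Real.sqrt_pos.2 (by norm_num)
  have hs23 : (0 : ℝ) < Real.sqrt (2 / 3) := Real.sqrt_pos.2 (by norm_num)
  have hs3' : (1 : ℝ) ≤ Real.sqrt 3 := by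
    rw [show (1 : ℝ) = Real.sqrt 1 by simp]
    exact Real.sqrt_le_sqrt (by norm_num)
  have hs23' : (1 / 2 : ℝ) ≤ Real.sqrt (2 / 3) := by
    rw [show (1 / 2 : ℝ) = Real.sqrt (1 / 4) by
      rw [show (1 / 4 : ℝ) = (1 / 2) ^ 2 by norm_num, Real.sqrt_sq (by norm_num)]]
    exact Real.sqrt_le_sqrt (by norm_num)
  let Ml : EuclideanSpace ℝ (Fin 3) →ₗ[ℝ] EuclideanSpace ℝ (Fin 3) :=
    { toFun := fun v => (v 0 - v 1 / Real.sqrt 3) • D₁ + (2 * v 1 / Real.sqrt 3) • D₂ + (v 2 / (2 * Real.sqrt (2 / 3))) • D₃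
      map_add' := fun v w => by
        simp only [PiLp.add_apply]
        rw [show (v 0 + w 0 - (v 1 + w 1) / Real.sqrt 3) = (v 0 - v 1 / Real.sqrt 3) + (w 0 - w 1 / Real.sqrt 3) by ring,
          show 2 * (v 1 + w 1) / Real.sqrt 3 = 2 * v 1 / Real.sqrt 3 + 2 * w 1 / Real.sqrt 3 by ring,
          show (v 2 + w 2) / (2 * Real.sqrt (2 / 3)) = v 2 / (2 * Real.sqrt (2 / 3)) + w 2 / (2 * Real.sqrt (2 / 3)) by ring,
          add_smul, add_smul, add_smul]
        abel
      map_smul' := fun a v => by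
        simp only [PiLp.smul_apply, smul_eq_mul, RingHom.id_apply, smul_add, smul_smul]
        congr 1
        · congr 1 <;> (congr 1; field_simp)
        · congr 1; field_simp }
  have hbound : ∀ v : EuclideanSpace ℝ (Fin 3), ‖Ml v‖ ≤ 3 * (‖D₁‖ + ‖D₂‖ + ‖D₃‖) * ‖v‖ := by
    intro v
    have h0 : |v 0| ≤ ‖v‖ := by
      have := EuclideanSpace.norm_eq v
      have h := PiLp.norm_apply_le (p := 2) v 0
      rwa [Real.norm_eq_abs] at h
    have h1 : |v 1| ≤ ‖v‖ := by
      have h := PiLp.norm_apply_le (p := 2) v 1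
      rwa [Real.norm_eq_abs] at h
    have h2 : |v 2| ≤ ‖v‖ := by
      have h := PiLp.norm_apply_le (p := 2) v 2
      rwa [Real.norm_eq_abs] at h
    have ha : |v 0 - v 1 / Real.sqrt 3| ≤ 2 * ‖v‖ := by
      refine (abs_sub _ _).trans ?_
      rw [abs_div, abs_of_pos hs3]
      have : |v 1| / Real.sqrt 3 ≤ |v 1| := div_le_self (abs_nonneg _) hs3'
      linarith
    have hb : |2 * v 1 / Real.sqrt 3| ≤ 2 * ‖v‖ := by
      rw [abs_div, abs_mul, abs_of_pos hs3, abs_two]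
      rw [div_le_iff₀ hs3]
      nlinarith [abs_nonneg (v 1)]
    have hc : |v 2 / (2 * Real.sqrt (2 / 3))| ≤ ‖v‖ := by
      rw [abs_div, abs_mul, abs_two, abs_of_pos hs23, div_le_iff₀ (by positivity)]
      nlinarith [abs_nonneg (v 2), norm_nonneg v]
    calc ‖Ml v‖ = ‖(v 0 - v 1 / Real.sqrt 3) • D₁ + (2 * v 1 / Real.sqrt 3) • D₂ + (v 2 / (2 * Real.sqrt (2 / 3))) • D₃‖ := rfl
      _ ≤ ‖(v 0 - v 1 / Real.sqrt 3) • D₁‖ + ‖(2 * v 1 / Real.sqrt 3) • D₂‖ + ‖(v 2 / (2 * Real.sqrt (2 / 3))) • D₃‖ := by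
          have := norm_add_le ((v 0 - v 1 / Real.sqrt 3) • D₁ + (2 * v 1 / Real.sqrt 3) • D₂) ((v 2 / (2 * Real.sqrt (2 / 3))) • D₃)
          have := norm_add_le ((v 0 - v 1 / Real.sqrt 3) • D₁) ((2 * v 1 / Real.sqrt 3) • D₂)
          linarith
      _ = |v 0 - v 1 / Real.sqrt 3| * ‖D₁‖ + |2 * v 1 / Real.sqrt 3| * ‖D₂‖ + |v 2 / (2 * Real.sqrt (2 / 3))| * ‖D₃‖ := by
          rw [norm_smul, norm_smul, norm_smul, Real.norm_eq_abs, Real.norm_eq_abs, Real.norm_eq_abs]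
      _ ≤ 2 * ‖v‖ * ‖D₁‖ + 2 * ‖v‖ * ‖D₂‖ + ‖v‖ * ‖D₃‖ := by
          gcongr
      _ ≤ 3 * (‖D₁‖ + ‖D₂‖ + ‖D₃‖) * ‖v‖ := by
          nlinarith [norm_nonneg v, norm_nonneg D₁, norm_nonneg D₂, norm_nonneg D₃]
  refine ⟨Ml.mkContinuous (3 * (‖D₁‖ + ‖D₂‖ + ‖D₃‖)) hbound, fun v => rfl, ?_⟩
  exact LinearMap.mkContinuous_norm_le _ (by positivity) _

/-- The coordinate map evaluated on lattice vectors: `M z(i,j,k) = i • D₁ + j • D₂ + k • D₃`. [folklore] -/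
theorem coordMap_latticeVec {D₁ D₂ D₃ : EuclideanSpace ℝ (Fin 3)} {M : EuclideanSpace ℝ (Fin 3) →L[ℝ] EuclideanSpace ℝ (Fin 3)}
    (hM : ∀ v : EuclideanSpace ℝ (Fin 3), M v = (v 0 - v 1 / Real.sqrt 3) • D₁ + (2 * v 1 / Real.sqrt 3) • D₂ +
      (v 2 / (2 * Real.sqrt (2 / 3))) • D₃) (i j k : ℤ) :
    M ((i : ℝ) • triangularVec₁ 1 + (j : ℝ) • triangularVec₂ 1 + (k : ℝ) • layerNormal (2 * Real.sqrt (2 / 3))) =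
      (i : ℝ) • D₁ + (j : ℝ) • D₂ + (k : ℝ) • D₃ := by
  obtain ⟨h0, h1, h2⟩ := hcpLiouvilleLam_apply i j k
  have hs3 : (Real.sqrt 3 : ℝ) ≠ 0 := (Real.sqrt_pos.2 (by norm_num)).ne'
  have hs23 : (Real.sqrt (2 / 3) : ℝ) ≠ 0 := (Real.sqrt_pos.2 (by norm_num)).ne'
  rw [hM]
  simp only at h0 h1 h2
  rw [h0, h1, h2]
  have ea : (i : ℝ) + j * 2⁻¹ - j * (√3 / 2) / Real.sqrt 3 = i := by field_simp; ring
  have eb : 2 * ((j : ℝ) * (√3 / 2)) / Real.sqrt 3 = j := by field_simp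
  have ec : (k : ℝ) * (2 * Real.sqrt (2 / 3)) / (2 * Real.sqrt (2 / 3)) = k := by field_simp
  rw [ea, eb, ec]

/-- **The linear part attached to three lattice differences** (see the module docstring). [folklore] -/
theorem exists_linearPart {A : EuclideanSpace ℝ (Fin 3) →L[ℝ] EuclideanSpace ℝ (Fin 3)} (hA : Adm₀ A)
    (D₁ D₂ D₃ : EuclideanSpace ℝ (Fin 3)) :
    ∃ B : EuclideanSpace ℝ (Fin 3) →L[ℝ] EuclideanSpace ℝ (Fin 3),
      (∀ i j k : ℤ, B (A ((i : ℝ) • triangularVec₁ 1 + (j : ℝ) • triangularVec₂ 1 +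
        (k : ℝ) • layerNormal (2 * Real.sqrt (2 / 3)))) = (i : ℝ) • D₁ + (j : ℝ) • D₂ + (k : ℝ) • D₃) ∧
      ‖B‖ ≤ 4 * (‖D₁‖ + ‖D₂‖ + ‖D₃‖) := by
  obtain ⟨M, hM, hMn⟩ := exists_coordMap D₁ D₂ D₃
  -- A as a continuous linear equivalence
  let Ae : EuclideanSpace ℝ (Fin 3) ≃L[ℝ] EuclideanSpace ℝ (Fin 3) :=
    (LinearEquiv.ofBijective (A : EuclideanSpace ℝ (Fin 3) →ₗ[ℝ] EuclideanSpace ℝ (Fin 3))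
      ⟨injective_of_adm₀ hA, surjective_of_adm₀ hA⟩).toContinuousLinearEquiv
  have hAe : ∀ v, Ae v = A v := fun v => rfl
  -- norm of the inverse
  have hinv : ∀ y, ‖Ae.symm y‖ ≤ 200 / 189 * ‖y‖ := by
    intro y
    have h := hcpLiouvilleAdm_norm_le hA (Ae.symm y)
    have : A (Ae.symm y) = y := by rw [← hAe]; exact Ae.apply_symm_apply y
    rw [this] at h
    nlinarith [norm_nonneg y]
  refine ⟨M.comp (Ae.symm : EuclideanSpace ℝ (Fin 3) →L[ℝ] EuclideanSpace ℝ (Fin 3)), ?_, ?_⟩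
  · intro i j k
    rw [ContinuousLinearMap.comp_apply, ContinuousLinearEquiv.coe_coe, ← hAe, Ae.symm_apply_apply]
    exact coordMap_latticeVec hM i j k
  · refine ContinuousLinearMap.opNorm_le_bound _ (by positivity) fun y => ?_
    rw [ContinuousLinearMap.comp_apply, ContinuousLinearEquiv.coe_coe]
    calc ‖M (Ae.symm y)‖ ≤ ‖M‖ * ‖Ae.symm y‖ := M.le_opNorm _
      _ ≤ 3 * (‖D₁‖ + ‖D₂‖ + ‖D₃‖) * (200 / 189 * ‖y‖) :=
          mul_le_mul hMn (hinv y) (norm_nonneg _) (by positivity)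
      _ ≤ 4 * (‖D₁‖ + ‖D₂‖ + ‖D₃‖) * ‖y‖ := by
          nlinarith [norm_nonneg y, norm_nonneg D₁, norm_nonneg D₂, norm_nonneg D₃]

end Summit.AtomisticToContinuum.Crystallization.Theorems.ExcessDecayLiouville

end
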